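import Mathlib.RingTheory.AdicCompletion.Noetherian
import Mathlib.LinearAlgebra.TensorProduct.RightExactness
import Mathlib.LinearAlgebra.TensorProduct.Quotient
import Mathlib.LinearAlgebra.FreeModule.PID
import Mathlib.LinearAlgebra.Dimension.Free
import Mathlib.RingTheory.TensorProduct.Free
import Mathlib.RingTheory.Ideal.Quotient.Index
import Literature.Algebra.Module.CompleteNakayama
import HarnessLib

/-!
# Finite generation from a finite reduction (Nakayama over a complete ring, down a scalar tower) and
# `#(R/I)^{rank} ≤ #(M/IM)` over a PID — the generic algebra under the CM-side (S4) brick of crux (R≥)ᵖ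

Route `ResidualThetaTransportAtTwo` (RTT), crux (R≥)ᵖ `ResidualThetaCountLowerPureAtTwo`
(stmt-BirchSwinnertonDyer-26074); seat `prover-bsd-wall-rtt-p2` g11 (`--supports`, closes nothing).
HONEST FRAMING: THEOREMS ONLY (no definition, no named fact, no instance, no `sorry`); pure commutative
algebra; BSD is not proved by any of this. Companion file `…LambdaLowerBoundO` specialises to
`𝒪 = 𝒪_E` (`E/ℚ_p` finite) and `Λ_𝒪 = 𝒪⟦T⟧` (memo `Cruxes/ResidualThetaCountLowerPureAtTwo/LINE-DESIGN-g11.md`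
§2 (g)): on the CM side of the crux the residual count `#(X/ϖX)` must become the λ-lower bound
`q^{λ_𝒪(X)} ≤ #(X/ϖX)`, which needs `X` finitely generated over `𝒪`; that is NOT an input there — it
follows from the finiteness of `X/ϖX` by the first theorem below.

WHAT.
* §1 (scalar tower `R → A`, `X` an `A`-module): `pow_smul_top_le_restrictScalars`;
  **`isHausdorff_of_isScalarTower`** (`A` Noetherian local, `X` f.g. over `A`, `I·A ⊆ 𝔪_A` ⇒ `X` is
  `I`-adically separated as an `R`-module, Krull); **`moduleFinite_of_finite_quotient`** (+ `R`
  `I`-adically precomplete and `X/IX` f.g. over `R` ⇒ `X` f.g. over `R`; the tree's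
  `Literature.Algebra.Module.finite_of_isHausdorff_of_forall_mem_sup`, Matsumura Thm. 8.4).
* §2 precompleteness bookkeeping: `isPrecomplete_of_forall_coe_eq` (same filtration, other scalar
  ring), `isPrecomplete_of_pow_le` (`Jᵉ ⊆ I ⊆ J`).
* §4 (PID `R`, fraction field `K`, ideal `I` of finite index; the `𝒪`-twin of the `ℤ_p`-file
  `…LambdaLeCardQuotient`, p613549): `subsingleton_baseChange_torsion`,
  `finrank_baseChange_eq_finrank_quotientTorsion` (`dim_K(K ⊗ M) = rank_R(M/M_tors)`),
  `natCard_quotient_smul_top_of_free` (`#(F/IF) = #(R/I)^{rank F}`),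
  **`pow_finrank_baseChange_le_natCard_quotient`** (`#(R/I)^{dim_K(K ⊗ M)} ≤ #(M/IM)`).

References: [Matsumura1987] Thm. 8.4, Thm. 8.10; [Washington1997] §13.2.
-/

set_option autoImplicit false
-- the Theorems namespace of this sub repeats the summit name by design (D-0017 nested layout)
set_option linter.dupNamespace false

noncomputable section

open scoped TensorProduct Pointwise

namespace Summit.BirchSwinnertonDyer.BirchSwinnertonDyer.Theorems.LambdaLowerBoundO

universe u v w

/-! ### §1. Separatedness down a scalar tower; finite generation from a finitely generated reduction -/

section Tower

variable {R : Type u} {A : Type v} [CommRing R] [CommRing A] [Algebra R A]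
  {X : Type w} [AddCommGroup X] [Module A X] [Module R X] [IsScalarTower R A X]

/-- `IⁿX ⊆ (I·A)ⁿX` along a scalar tower `R → A → End X`. [folklore] -/
theorem pow_smul_top_le_restrictScalars (I : Ideal R) (n : ℕ) :
    (I ^ n • ⊤ : Submodule R X) ≤
      ((I.map (algebraMap R A)) ^ n • ⊤ : Submodule A X).restrictScalars R := by
  induction n with
  | zero =>
    intro x _
    rw [Submodule.restrictScalars_mem, pow_zero, Ideal.one_eq_top, Submodule.top_smul]
    exact Submodule.mem_top
  | succ n ih =>
    rw [pow_succ', Submodule.mul_smul]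
    refine Submodule.smul_le.2 fun r hr x hx => ?_
    have hx' := ih hx
    rw [Submodule.restrictScalars_mem] at hx' ⊢
    rw [pow_succ', Submodule.mul_smul, ← algebraMap_smul A r x]
    exact Submodule.smul_mem_smul (Ideal.mem_map_of_mem _ hr) hx'

/-- **Separatedness transfers down a scalar tower.** If `A` is a Noetherian local `R`-algebra with
`I·A ⊆ 𝔪_A` and `X` is a finitely generated `A`-module, then `X` is `I`-adically separated as an
`R`-module: `⋂ IⁿX ⊆ ⋂ 𝔪_AⁿX = 0` (Krull's intersection theorem, Mathlib `IsHausdorff (maximalIdeal A) X`).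
[cite: Matsumura1987, Theorem 8.10] -/
theorem isHausdorff_of_isScalarTower [IsNoetherianRing A] [IsLocalRing A] [Module.Finite A X]
    (I : Ideal R) (hI : I.map (algebraMap R A) ≤ IsLocalRing.maximalIdeal A) : IsHausdorff I X := by
  refine ⟨fun x hx => ?_⟩
  have key : ∀ n : ℕ, x ≡ 0 [SMOD ((IsLocalRing.maximalIdeal A) ^ n • ⊤ : Submodule A X)] := by
    intro n
    have h := hx n
    rw [SModEq.zero] at h ⊢
    have h' := pow_smul_top_le_restrictScalars (A := A) I n h
    rw [Submodule.restrictScalars_mem] at h'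
    exact Submodule.smul_mono_left (Ideal.pow_right_mono hI n) h'
  exact IsHausdorff.haus (inferInstance : IsHausdorff (IsLocalRing.maximalIdeal A) X) x key

/-- **Finite generation from a finitely generated reduction** (Nakayama over a complete ring for a
separated module, tree `Literature.Algebra.Module.finite_of_isHausdorff_of_forall_mem_sup`): with
`R` `I`-adically precomplete, `A` a Noetherian local `R`-algebra with `I·A ⊆ 𝔪_A`, `X` finitely
generated over `A` and `X/IX` finitely generated over `R`, the module `X` is finitely generated over
`R`. [cite: Matsumura1987, Theorem 8.4] -/
theorem moduleFinite_of_finite_quotient [IsNoetherianRing A] [IsLocalRing A] [Module.Finite A X]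
    (I : Ideal R) [IsPrecomplete I R] (hI : I.map (algebraMap R A) ≤ IsLocalRing.maximalIdeal A)
    [hfin : Module.Finite R (X ⧸ (I • ⊤ : Submodule R X))] : Module.Finite R X := by
  classical
  haveI : IsHausdorff I X := isHausdorff_of_isScalarTower (A := A) I hI
  obtain ⟨s, hs⟩ := hfin.fg_top
  let x : ↥s → X := fun y => ((I • ⊤ : Submodule R X).mkQ_surjective y.1).choose
  have hx : ∀ y : ↥s, (I • ⊤ : Submodule R X).mkQ (x y) = y.1 := fun y =>
    ((I • ⊤ : Submodule R X).mkQ_surjective y.1).choose_spec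
  have hrange : (I • ⊤ : Submodule R X).mkQ '' Set.range x = (s : Set (X ⧸ (I • ⊤ : Submodule R X))) := by
    ext y
    simp only [Set.mem_image, Set.mem_range, Finset.mem_coe]
    constructor
    · rintro ⟨w, ⟨z, hz⟩, hw⟩
      rw [← hw, ← hz, hx z]
      exact z.2
    · intro hy
      exact ⟨x ⟨y, hy⟩, ⟨⟨y, hy⟩, rfl⟩, hx ⟨y, hy⟩⟩
  have hspan : Submodule.span R (Set.range x) ⊔ (I • ⊤ : Submodule R X) = ⊤ := by
    have hmap : (Submodule.span R (Set.range x)).map (I • ⊤ : Submodule R X).mkQ = ⊤ := by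
      rw [Submodule.map_span, hrange, hs]
    have := Submodule.comap_map_eq (I • ⊤ : Submodule R X).mkQ (Submodule.span R (Set.range x))
    rw [hmap, Submodule.comap_top, Submodule.ker_mkQ] at this
    exact this.symm
  refine Literature.Algebra.Module.finite_of_isHausdorff_of_forall_mem_sup I x fun m => ?_
  rw [hspan]
  exact Submodule.mem_top

end Tower

/-! ### §2. Precompleteness bookkeeping -/

section Precomplete

/-- Precompleteness only depends on the filtration: if `IⁿM` (for scalars `R`) and `JⁿM` (for
scalars `S`) are the same subgroups of `M` for every `n`, then `M` is `I`-adically precomplete iff it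
is `J`-adically precomplete (one direction). [folklore] -/
theorem isPrecomplete_of_forall_coe_eq {R : Type u} {S : Type v} {M : Type w} [CommRing R]
    [CommRing S] [AddCommGroup M] [Module R M] [Module S M] (I : Ideal R) (J : Ideal S)
    (h : ∀ n : ℕ, ((I ^ n • ⊤ : Submodule R M) : Set M) = ((J ^ n • ⊤ : Submodule S M) : Set M))
    [IsPrecomplete I M] : IsPrecomplete J M := by
  refine ⟨fun f hf => ?_⟩
  have hf' : ∀ {m n : ℕ}, m ≤ n → f m ≡ f n [SMOD (I ^ m • ⊤ : Submodule R M)] := by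
    intro m n hmn
    have := hf hmn
    rw [SModEq.sub_mem] at this ⊢
    change f m - f n ∈ ((I ^ m • ⊤ : Submodule R M) : Set M)
    rw [h m]
    exact this
  obtain ⟨L, hL⟩ := IsPrecomplete.prec (inferInstance : IsPrecomplete I M) hf'
  refine ⟨L, fun n => ?_⟩
  have := hL n
  rw [SModEq.sub_mem] at this ⊢
  change f n - L ∈ ((J ^ n • ⊤ : Submodule S M) : Set M)
  rw [← h n]
  exact this

/-- If `Jᵉ ⊆ I ⊆ J` with `e ≥ 1`, an `I`-adically precomplete module is `J`-adically precomplete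
(the two topologies coincide). [folklore] -/
theorem isPrecomplete_of_pow_le {R : Type u} {M : Type w} [CommRing R] [AddCommGroup M] [Module R M]
    {I J : Ideal R} {e : ℕ} (he : 0 < e) (hJI : J ^ e ≤ I) (hIJ : I ≤ J) [IsPrecomplete I M] :
    IsPrecomplete J M := by
  refine ⟨fun f hf => ?_⟩
  -- the subsequence `g k = f (e k)` is `I`-adically Cauchy
  have hg : ∀ {m n : ℕ}, m ≤ n → f (e * m) ≡ f (e * n) [SMOD (I ^ m • ⊤ : Submodule R M)] := by
    intro m n hmn
    have h1 : f (e * m) ≡ f (e * n) [SMOD (J ^ (e * m) • ⊤ : Submodule R M)] :=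
      hf (Nat.mul_le_mul_left e hmn)
    rw [SModEq.sub_mem] at h1 ⊢
    have hle : (J ^ (e * m) • ⊤ : Submodule R M) ≤ I ^ m • ⊤ := by
      rw [pow_mul]
      exact Submodule.smul_mono_left (Ideal.pow_right_mono hJI m)
    exact hle h1
  obtain ⟨L, hL⟩ := IsPrecomplete.prec (inferInstance : IsPrecomplete I M) hg
  refine ⟨L, fun n => ?_⟩
  have hn : n ≤ e * n := Nat.le_mul_of_pos_left n he
  have h1 : f n ≡ f (e * n) [SMOD (J ^ n • ⊤ : Submodule R M)] := hf hn
  have h2 : f (e * n) ≡ L [SMOD (J ^ n • ⊤ : Submodule R M)] := by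
    have := hL n
    rw [SModEq.sub_mem] at this ⊢
    exact Submodule.smul_mono_left (Ideal.pow_right_mono hIJ n) this
  exact h1.trans h2

end Precomplete


/-! ### §4. `#(R/I)^{dim_K(K ⊗ M)} ≤ #(M/IM)` over a principal ideal domain `R` with fraction field `K` -/

section PID

variable {R : Type u} [CommRing R] [IsDomain R] [IsPrincipalIdealRing R]
  (K : Type v) [Field K] [Algebra R K] [IsFractionRing R K]

omit [IsDomain R] [IsPrincipalIdealRing R] in
/-- **`K ⊗_R T = 0` for the torsion submodule `T`** (`q ⊗ t = (q/a) ⊗ a·t = 0`, `a ≠ 0` a unit of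
`K`). [folklore] -/
theorem subsingleton_baseChange_torsion (M : Type w) [AddCommGroup M] [Module R M] :
    Subsingleton (K ⊗[R] (Submodule.torsion R M)) := by
  refine ⟨fun z w => ?_⟩
  suffices h : ∀ z : K ⊗[R] (Submodule.torsion R M), z = 0 by rw [h z, h w]
  intro z
  induction z using TensorProduct.induction_on with
  | zero => rfl
  | tmul q t =>
    obtain ⟨a, ha⟩ := (Submodule.mem_torsion_iff (t : M)).mp t.2
    have hu : IsUnit (algebraMap R K (a : R)) := IsLocalization.map_units K a
    have hq : q = (a : R) • (q * hu.unit⁻¹.1) := by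
      rw [Algebra.smul_def, mul_left_comm, IsUnit.mul_val_inv, mul_one]
    have hat : (a : R) • t = 0 := by
      apply Subtype.ext
      change (a : R) • (t : M) = 0
      exact ha
    rw [hq, TensorProduct.smul_tmul, hat, TensorProduct.tmul_zero]
  | add x y hx hy => rw [hx, hy, add_zero]

/-- **`dim_K (K ⊗_R M) = rank_R (M/T)`**, `T` the torsion submodule: `K ⊗ M ⥲ K ⊗ (M/T)` (right
exactness and `K ⊗ T = 0`), and `M/T` is finitely generated torsion-free, hence free, over the PID `R`.
[cite: Washington1997, §13.2] -/
theorem finrank_baseChange_eq_finrank_quotientTorsion (M : Type w) [AddCommGroup M] [Module R M]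
    [Module.Finite R M] :
    Module.finrank K (K ⊗[R] M) = Module.finrank R (M ⧸ Submodule.torsion R M) := by
  set T := Submodule.torsion R M with hT
  haveI : Module.Free R (M ⧸ T) := Module.free_of_finite_type_torsion_free'
  have hexact := lTensor_exact K (LinearMap.exact_subtype_mkQ T) (Submodule.mkQ_surjective T)
  have hsurj : Function.Surjective ((Submodule.mkQ T).lTensor K) :=
    LinearMap.lTensor_surjective K (Submodule.mkQ_surjective T)
  have hinj : Function.Injective ((Submodule.mkQ T).lTensor K) := by
    haveI := subsingleton_baseChange_torsion (R := R) K M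
    rw [← LinearMap.ker_eq_bot, LinearMap.exact_iff.mp hexact, LinearMap.range_eq_bot]
    exact Subsingleton.elim _ _
  have hbij : Function.Bijective ((Submodule.mkQ T).baseChange K) := by
    rw [Function.Bijective, LinearMap.baseChange_eq_ltensor]
    exact ⟨hinj, hsurj⟩
  rw [(LinearEquiv.ofBijective _ hbij).finrank_eq]
  exact Module.finrank_baseChange

omit [IsDomain R] [IsPrincipalIdealRing R] in
/-- **`#(F/IF) = #(R/I)^{rank F}`** for a finite free module `F` over a (nontrivial) commutative ring:
`F/IF ≅ (R/I) ⊗_R F ≅ (R/I)^{rank F}`. [folklore] -/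
theorem natCard_quotient_smul_top_of_free [Nontrivial R] (I : Ideal R) (F : Type w) [AddCommGroup F]
    [Module R F] [Module.Free R F] [Module.Finite R F] :
    Nat.card (F ⧸ (I • ⊤ : Submodule R F)) = Nat.card (R ⧸ I) ^ Module.finrank R F := by
  classical
  let b := Module.Free.chooseBasis R F
  let bq := Algebra.TensorProduct.basis (R ⧸ I) b
  have e : (F ⧸ (I • ⊤ : Submodule R F)) ≃ (Module.Free.ChooseBasisIndex R F → R ⧸ I) :=
    (TensorProduct.quotTensorEquivQuotSMul F I).symm.toEquiv.trans bq.equivFun.toEquiv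
  rw [Nat.card_congr e, Nat.card_fun, Module.finrank_eq_card_chooseBasisIndex,
    ← Nat.card_eq_fintype_card]

/-- **`#(R/I)^{dim_K(K ⊗_R M)} ≤ #(M/IM)`** for every finitely generated module `M` over a PID `R`
with fraction field `K` and every ideal `I` of finite index: `M/IM` maps onto `(M/T)/I(M/T)`, of order
`#(R/I)^{rank(M/T)}` (torsion only ENLARGES `M/IM`; no torsion-freeness hypothesis).
[cite: Washington1997, §13.2] -/
theorem pow_finrank_baseChange_le_natCard_quotient (I : Ideal R) [Finite (R ⧸ I)] (M : Type w)
    [AddCommGroup M] [Module R M] [Module.Finite R M] :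
    Nat.card (R ⧸ I) ^ Module.finrank K (K ⊗[R] M) ≤
      Nat.card (M ⧸ (I • ⊤ : Submodule R M)) := by
  set T := Submodule.torsion R M with hT
  haveI : Module.Free R (M ⧸ T) := Module.free_of_finite_type_torsion_free'
  haveI : Finite (M ⧸ (I • ⊤ : Submodule R M)) := by
    haveI : Finite (M ⧸ (⊤ : Submodule R M)) := by
      haveI : Subsingleton (M ⧸ (⊤ : Submodule R M)) := Submodule.Quotient.subsingleton_iff.mpr rfl
      infer_instance
    exact Submodule.finite_quotient_smul I Module.Finite.fg_top
  rw [finrank_baseChange_eq_finrank_quotientTorsion K M, ← natCard_quotient_smul_top_of_free I (M ⧸ T)]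
  -- the surjection `M/IM → (M/T)/I(M/T)`
  have hle : (I • (⊤ : Submodule R M)) ≤ (I • (⊤ : Submodule R (M ⧸ T))).comap (Submodule.mkQ T) := by
    rw [← Submodule.map_le_iff_le_comap, Submodule.map_smul'', Submodule.map_top, Submodule.range_mkQ]
  refine Nat.card_le_card_of_surjective (Submodule.mapQ _ _ (Submodule.mkQ T) hle) ?_
  rintro ⟨x⟩
  obtain ⟨y, rfl⟩ := Submodule.mkQ_surjective T x
  exact ⟨Submodule.Quotient.mk y, rfl⟩

end PID


end Summit.BirchSwinnertonDyer.BirchSwinnertonDyer.Theorems.LambdaLowerBoundO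

end
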